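import Summits.MatrixMultiplication.MatrixMultiplication.Theorems.AbelianSTPPCensusTECertState

/-!
# Certificate checker for `ShapeExclusionTE`: soundness of the search (`scanShapes`, `scanTiers`, `node`, `topScan`)

Cell mm-stpp, route `AbelianSTPPCensus`, crux `ShapeExclusionTE` (stmt-MatrixMultiplication-19759); see the module docstring of
`AbelianSTPPCensusTECertDefs.lean` for the design of the certificate checker.  Support file (no new definitions).

Content: `teRun_sound` — if `teRun M lo hi (rowsDesc n)` accepts (`M ≤ n`, `M ≤ 127`), every family with `AdmM M`,
value sum `> K·M`, and a sorted member of maximal volume in `[lo, hi)` contains a registered residual.  The proof is a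
double induction (fuel / candidate lists) on the invariant `Placed`: every remaining member has its record among the
current candidates or in a later tier.
-/

-- single-conjunct summit: the mandated namespace repeats `MatrixMultiplication`.
set_option linter.dupNamespace false

namespace Summit.MatrixMultiplication.MatrixMultiplication.Theorems.TECert
/-! ## The scans and the node -/

section Scan

variable {M : ℕ} {F : Multiset (ℕ × ℕ × ℕ)}

/-- Soundness of `scanShapes` at a node `H`, relative to a sound child procedure `nd` and a sound `rest`. -/
theorem scanShapes_sound (hA : AdmM M F) (hbeat : K * M < sumVal F)
    {f : ℕ} {nd : St → List ℕ → List SRec → List Tier → Bool}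
    (hnd : ∀ (H : List (ℕ × ℕ × ℕ)) (row : List ℕ) (cur : List SRec) (T : List Tier) (V₀ : ℕ),
      (H : Multiset (ℕ × ℕ × ℕ)) ≤ F → Multiset.card (F - (H : Multiset (ℕ × ℕ × ℕ))) < f →
      row.length = Bmax + 1 → Dom row (Cov V₀) → (∀ s ∈ cur, s.V ≤ V₀) → (∀ τ ∈ T, τ.V ≤ V₀) → TiersOK T →
      Placed M (F - (H : Multiset (ℕ × ℕ × ℕ))) cur T → nd (stOf M H) row cur T = true → ResidualM M F)
    {H : List (ℕ × ℕ × ℕ)} (hH : (H : Multiset (ℕ × ℕ × ℕ)) ≤ F) (hcard : Multiset.card (F - (H : Multiset (ℕ × ℕ × ℕ))) < f + 1)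
    {row : List ℕ} {V₀ : ℕ} (hlen : row.length = Bmax + 1) (hdom : Dom row (Cov V₀))
    {T : List Tier} (hT : ∀ τ ∈ T, τ.V ≤ V₀) (hTok : TiersOK T)
    {rest : Bool} (hrest : Placed M (F - (H : Multiset (ℕ × ℕ × ℕ))) [] T → rest = true → ResidualM M F) :
    ∀ cur : List SRec, (∀ s ∈ cur, s.V ≤ V₀) → Placed M (F - (H : Multiset (ℕ × ℕ × ℕ))) cur T →
      scanShapes M nd (stOf M H) row T rest cur = true → ResidualM M F
  | [], _, hpl, h => hrest hpl (by simpa [scanShapes] using h)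
  | s :: sh, hcur, hpl, h => by
    simp only [scanShapes, Bool.and_eq_true] at h
    obtain ⟨hchild, htail⟩ := h
    by_cases hts : ∃ t ∈ F - (H : Multiset (ℕ × ℕ × ℕ)), mkRec M t.1 t.2.1 t.2.2 = s
    · obtain ⟨t, ht, rfl⟩ := hts
      have hle : ((t :: H : List _) : Multiset (ℕ × ℕ × ℕ)) ≤ F := cons_le hH ht
      have hok : okSt M (upd (stOf M H) (mkRec M t.1 t.2.1 t.2.2)) = true := by
        rw [← stOf_cons]; exact okSt_stOf hA hle
      rw [if_pos hok, ← stOf_cons] at hchild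
      refine hnd (t :: H) row _ T V₀ hle ?_ hlen hdom hcur hT hTok ?_ hchild
      · have h1 := card_split hle
        have h2 := card_split hH
        simp only [List.length_cons] at h1
        omega
      · intro t' ht'
        have hHle : (H : Multiset (ℕ × ℕ × ℕ)) ≤ ((t :: H : List _) : Multiset (ℕ × ℕ × ℕ)) := by
          rw [← Multiset.cons_coe]; exact Multiset.le_cons_self _ _
        have : t' ∈ F - (H : Multiset (ℕ × ℕ × ℕ)) := Multiset.mem_of_le (tsub_le_tsub_left hHle F) ht'
        exact hpl t' this
    · push Not at hts
      refine scanShapes_sound hA hbeat hnd hH hcard hlen hdom hT hTok hrest sh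
        (fun s' hs' => hcur s' (List.mem_cons_of_mem _ hs')) ?_ htail
      intro t' ht'
      rcases hpl t' ht' with h | h
      · rcases List.mem_cons.mp h with h | h
        · exact absurd h (hts t' ht')
        · exact Or.inl h
      · exact Or.inr h

/-- Every remaining member is covered by the row class of a volume bounding the candidates. -/
theorem cov_of_placed (hA : AdmM M F) (hM : M ≤ 127) {H : List (ℕ × ℕ × ℕ)} {cur : List SRec} {T : List Tier}
    {V₀ : ℕ} (hcur : ∀ s ∈ cur, s.V ≤ V₀) (hT : ∀ τ ∈ T, τ.V ≤ V₀) (hTok : TiersOK T)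
    (hpl : Placed M (F - (H : Multiset (ℕ × ℕ × ℕ))) cur T) : ∀ t ∈ F - (H : Multiset (ℕ × ℕ × ℕ)), Cov V₀ t := by
  intro t ht
  obtain ⟨htab, -, -, -⟩ := hA
  obtain ⟨h1, h2, h3, ht4⟩ := htab t (Multiset.mem_of_le tsub_le_self ht)
  refine ⟨h1, h2, h3, tableOK_mono ht4 hM, ?_⟩
  have hV : (mkRec M t.1 t.2.1 t.2.2).V = vol t := rfl
  rcases hpl t ht with h | ⟨τ, hτ, hs⟩
  · have := hcur _ h; omega
  · have := (hTok.1 τ hτ).2.2 _ hs; have := hT τ hτ; omega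

/-- Soundness of `scanTiers` at a node `H`, relative to a sound child procedure `nd`. -/
theorem scanTiers_sound (hA : AdmM M F) (hbeat : K * M < sumVal F) (hM : M ≤ 127)
    {f : ℕ} {nd : St → List ℕ → List SRec → List Tier → Bool}
    (hnd : ∀ (H : List (ℕ × ℕ × ℕ)) (row : List ℕ) (cur : List SRec) (T : List Tier) (V₀ : ℕ),
      (H : Multiset (ℕ × ℕ × ℕ)) ≤ F → Multiset.card (F - (H : Multiset (ℕ × ℕ × ℕ))) < f →
      row.length = Bmax + 1 → Dom row (Cov V₀) → (∀ s ∈ cur, s.V ≤ V₀) → (∀ τ ∈ T, τ.V ≤ V₀) → TiersOK T →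
      Placed M (F - (H : Multiset (ℕ × ℕ × ℕ))) cur T → nd (stOf M H) row cur T = true → ResidualM M F)
    {H : List (ℕ × ℕ × ℕ)} (hH : (H : Multiset (ℕ × ℕ × ℕ)) ≤ F) (hcard : Multiset.card (F - (H : Multiset (ℕ × ℕ × ℕ))) < f + 1)
    (hsq : ¬ K * M < (stOf M H).sq) :
    ∀ T : List Tier, TiersOK T → Placed M (F - (H : Multiset (ℕ × ℕ × ℕ))) [] T → scanTiers M nd (stOf M H) T = true → ResidualM M F
  | [], _, hpl, _ => by
    -- no candidates left: the remaining family is empty, contradicting «beats»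
    exfalso
    have hΔ : F - (H : Multiset (ℕ × ℕ × ℕ)) = 0 := by
      rw [Multiset.eq_zero_iff_forall_notMem]
      intro t ht
      rcases hpl t ht with h | ⟨τ, hτ, -⟩
      · simp at h
      · simp at hτ
    have := sumVal_split (M := M) hH
    have h0 : sumVal (0 : Multiset (ℕ × ℕ × ℕ)) = 0 := by simp [sumVal]
    rw [hΔ, h0, add_zero] at this
    omega
  | τ :: T, hTok, hpl, h => by
    have hTok0 := hTok
    obtain ⟨hall, hpw⟩ := hTok
    obtain ⟨hlen, hdom, hshapes⟩ := hall τ List.mem_cons_self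
    rw [List.pairwise_cons] at hpw
    obtain ⟨hlt, hpw'⟩ := hpw
    have hTok' : TiersOK T := ⟨fun τ' h' => hall τ' (List.mem_cons_of_mem _ h'), hpw'⟩
    have hcov : ∀ t ∈ F - (H : Multiset (ℕ × ℕ × ℕ)), Cov τ.V t :=
      cov_of_placed hA hM (cur := []) (by simp) (T := τ :: T)
        (fun τ' h' => by
          rcases List.mem_cons.mp h' with rfl | h'
          · exact le_rfl
          · exact (hlt τ' h').le) hTok0 hpl
    simp only [scanTiers, Bool.or_eq_true] at h
    rcases h with hb | h
    · rw [not_break hA hbeat hH hlen hdom hcov] at hb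
      exact absurd hb (by simp)
    · by_cases hel : eligible M (stOf M H) τ.V = true
      · rw [if_pos hel] at h
        refine scanShapes_sound hA hbeat hnd hH hcard hlen hdom (T := T) (fun τ' h' => (hlt τ' h').le) hTok'
          (rest := scanTiers M nd (stOf M H) T)
          (fun hpl' hr => scanTiers_sound hA hbeat hM hnd hH hcard hsq T hTok' hpl' hr) τ.shapes
          (fun s hs => (hshapes s hs).le) ?_ h
        intro t ht
        rcases hpl t ht with h0 | ⟨τ', hτ', hs⟩
        · simp at h0
        · rcases List.mem_cons.mp hτ' with rfl | h'
          · exact Or.inl hs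
          · exact Or.inr ⟨τ', h', hs⟩
      · rw [if_neg hel] at h
        refine scanTiers_sound hA hbeat hM hnd hH hcard hsq T hTok' ?_ h
        intro t ht
        rcases hpl t ht with h0 | ⟨τ', hτ', hs⟩
        · simp at h0
        · rcases List.mem_cons.mp hτ' with rfl | h'
          · exfalso
            have hV : (mkRec M t.1 t.2.1 t.2.2).V = vol t := rfl
            have := hshapes _ hs
            rw [hV] at this
            rw [← this, eligible_of_mem hA hH ht] at hel
            exact hel rfl
          · exact Or.inr ⟨τ', h', hs⟩

/-- Soundness of a search node (induction on the fuel). -/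
theorem node_sound (hA : AdmM M F) (hbeat : K * M < sumVal F) (hM : M ≤ 127) :
    ∀ (f : ℕ) (H : List (ℕ × ℕ × ℕ)) (row : List ℕ) (cur : List SRec) (T : List Tier) (V₀ : ℕ),
      (H : Multiset (ℕ × ℕ × ℕ)) ≤ F → Multiset.card (F - (H : Multiset (ℕ × ℕ × ℕ))) < f →
      row.length = Bmax + 1 → Dom row (Cov V₀) → (∀ s ∈ cur, s.V ≤ V₀) → (∀ τ ∈ T, τ.V ≤ V₀) → TiersOK T →
      Placed M (F - (H : Multiset (ℕ × ℕ × ℕ))) cur T → node M f (stOf M H) row cur T = true → ResidualM M F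
  | 0, H, row, cur, T, V₀, _, _, _, _, _, _, _, _, h => by simp [node] at h
  | f + 1, H, row, cur, T, V₀, hH, hcard, hlen, hdom, hcur, hT, hTok, hpl, h => by
    simp only [node] at h
    by_cases hsq : K * M < (stOf M H).sq
    · rw [if_pos hsq] at h
      exact residual_of_resid hH h
    · rw [if_neg hsq, Bool.or_eq_true] at h
      rcases h with hb | h
      · rw [not_break hA hbeat hH hlen hdom (cov_of_placed hA hM hcur hT hTok hpl)] at hb
        exact absurd hb (by simp)
      · exact scanShapes_sound hA hbeat (node_sound hA hbeat hM f) hH hcard hlen hdom hT hTok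
          (fun hpl' hr => scanTiers_sound hA hbeat hM (node_sound hA hbeat hM f) hH hcard hsq T hTok hpl' hr)
          cur hcur hpl h

/-- `topShapes` tries every sorted shape of the tier. -/
theorem topShapes_find {row : List ℕ} {all : List SRec} {T : List Tier} :
    ∀ l : List SRec, topShapes M row all T l = true → ∀ s ∈ l, sorted3 s = true →
      node M (M + 1) (upd (emptySt M) s) row all T = true
  | [], _, s, hs, _ => by simp at hs
  | s' :: l, h, s, hs, hsort => by
    simp only [topShapes, Bool.and_eq_true] at h
    rcases List.mem_cons.mp hs with rfl | hs
    · simpa [hsort] using h.1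
    · exact topShapes_find l h.2 s hs hsort

/-- The tier list built from well-formed precomputed tiers is well formed and contains every table shape. -/
theorem mkTiers_spec (M : ℕ) : ∀ R : List RowRec,
    (∀ r ∈ R, r.row.length = Bmax + 1 ∧ Dom r.row (Cov r.V) ∧ r.triples = tierTriples r.V) →
    R.Pairwise (fun r r' => r'.V < r.V) →
      TiersOK (mkTiers M R) ∧ (∀ τ ∈ mkTiers M R, ∃ r ∈ R, τ.V = r.V) ∧
      (∀ r ∈ R, r.V ≤ M → ∀ t ∈ tierTriples r.V, tableOK M t.1 t.2.1 t.2.2 = true →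
        ∃ τ ∈ mkTiers M R, mkRec M t.1 t.2.1 t.2.2 ∈ τ.shapes)
  | [], _, _ => by simp [mkTiers, TiersOK]
  | r :: R, hR, hpw => by
    rw [List.pairwise_cons] at hpw
    obtain ⟨hlt, hpw'⟩ := hpw
    obtain ⟨ihok, ihV, ihmem⟩ := mkTiers_spec M R (fun r' h => hR r' (List.mem_cons_of_mem _ h)) hpw'
    obtain ⟨hlen, hdom, htr⟩ := hR r List.mem_cons_self
    -- shapes of this tier have volume r.V
    have hsh : ∀ s ∈ tierShapes M r, s.V = r.V := by
      intro s hs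
      simp only [tierShapes, List.mem_map, List.mem_filter] at hs
      obtain ⟨t, ⟨ht, -⟩, rfl⟩ := hs
      rw [htr] at ht
      exact (of_mem_tierTriples ht).2.2.2.1
    by_cases hcase : Nat.ble r.V M = true ∧ tierShapes M r ≠ []
    · obtain ⟨hb, hne⟩ := hcase
      obtain ⟨s, sh, hssh⟩ := List.exists_cons_of_ne_nil hne
      have hred : mkTiers M (r :: R) = ⟨r.V, r.row, s :: sh⟩ :: mkTiers M R := by
        simp [mkTiers, hb, hssh]
      rw [hred]
      refine ⟨⟨?_, ?_⟩, ?_, ?_⟩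
      · intro τ hτ
        rcases List.mem_cons.mp hτ with rfl | hτ
        · exact ⟨hlen, hdom, fun s' hs' => hsh s' (by rw [hssh]; exact hs')⟩
        · exact ihok.1 τ hτ
      · rw [List.pairwise_cons]
        refine ⟨fun τ' h' => ?_, ihok.2⟩
        obtain ⟨r', hr', hV⟩ := ihV τ' h'
        rw [hV]; exact hlt r' hr'
      · intro τ hτ
        rcases List.mem_cons.mp hτ with rfl | hτ
        · exact ⟨r, List.mem_cons_self, rfl⟩
        · obtain ⟨r', hr', hV⟩ := ihV τ hτ
          exact ⟨r', List.mem_cons_of_mem _ hr', hV⟩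
      · intro r' hr' hle t ht htab
        rcases List.mem_cons.mp hr' with rfl | hr'
        · refine ⟨⟨r'.V, r'.row, s :: sh⟩, List.mem_cons_self, ?_⟩
          show mkRec M t.1 t.2.1 t.2.2 ∈ s :: sh
          rw [← hssh]
          simp only [tierShapes, List.mem_map, List.mem_filter]
          exact ⟨t, ⟨by rw [htr]; exact ht, htab⟩, rfl⟩
        · obtain ⟨τ, hτ, hm⟩ := ihmem r' hr' hle t ht htab
          exact ⟨τ, List.mem_cons_of_mem _ hτ, hm⟩
    · have hred : mkTiers M (r :: R) = mkTiers M R := by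
        rw [not_and_or] at hcase
        rcases hcase with h | h
        · simp [mkTiers, h]
        · push Not at h; simp [mkTiers, h]
      rw [hred]
      refine ⟨ihok, fun τ hτ => ?_, ?_⟩
      · obtain ⟨r', hr', hV⟩ := ihV τ hτ
        exact ⟨r', List.mem_cons_of_mem _ hr', hV⟩
      · intro r' hr' hle t ht htab
        rcases List.mem_cons.mp hr' with rfl | hr'
        · exfalso
          rw [not_and_or] at hcase
          rcases hcase with h | h
          · simp only [Nat.ble_eq] at h; exact h hle
          · apply h
            apply List.ne_nil_of_mem (a := mkRec M t.1 t.2.1 t.2.2)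
            simp only [tierShapes, List.mem_map, List.mem_filter]
            exact ⟨t, ⟨by rw [htr]; exact ht, htab⟩, rfl⟩
        · obtain ⟨τ, hτ, hm⟩ := ihmem r' hr' hle t ht htab
          exact ⟨τ, hτ, hm⟩

/-- A family has at most `Σ ab` members. -/
theorem card_le_sumP (hA : AdmM M F) : Multiset.card F ≤ sumP F := by
  obtain ⟨htab, -, -, -⟩ := hA
  have : (F.map fun _ => 1).sum ≤ (F.map uu).sum :=
    Multiset.sum_map_le_sum_map _ _ fun t ht => by
      obtain ⟨h1, h2, -, -⟩ := htab t ht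
      exact Nat.mul_le_mul h1 h2
  simpa [sumP] using this

/-- The top level: a family whose member of maximal volume `s₁` is sorted and has volume in `[lo, hi)` is caught. -/
theorem top_sound (hA : AdmM M F) (hbeat : K * M < sumVal F) (hM : M ≤ 127) {s₁ : ℕ × ℕ × ℕ} (hs₁ : s₁ ∈ F)
    (hmax : ∀ t ∈ F, vol t ≤ vol s₁) (hsorted : s₁.2.1 ≤ s₁.1 ∧ s₁.2.2 ≤ s₁.2.1) {lo hi : ℕ}
    (hlo : lo ≤ vol s₁) (hhi : vol s₁ < hi) :
    ∀ L : List Tier, TiersOK L → topScan M lo hi L = true →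
      (∃ τ ∈ L, mkRec M s₁.1 s₁.2.1 s₁.2.2 ∈ τ.shapes) →
      Placed M (F - ([s₁] : List (ℕ × ℕ × ℕ))) [] L → ResidualM M F
  | [], _, _, ⟨τ, hτ, _⟩, _ => by simp at hτ
  | τ :: L, hTok, h, hex, hpl => by
    have hTok0 := hTok
    obtain ⟨hall, hpw⟩ := hTok
    obtain ⟨hlen, hdom, hshapes⟩ := hall τ List.mem_cons_self
    rw [List.pairwise_cons] at hpw
    obtain ⟨hlt, hpw'⟩ := hpw
    have hTok' : TiersOK L := ⟨fun τ' h' => hall τ' (List.mem_cons_of_mem _ h'), hpw'⟩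
    have hH : (([s₁] : List (ℕ × ℕ × ℕ)) : Multiset (ℕ × ℕ × ℕ)) ≤ F := by simpa using hs₁
    have hV1 : (mkRec M s₁.1 s₁.2.1 s₁.2.2).V = vol s₁ := rfl
    simp only [topScan, Bool.and_eq_true] at h
    obtain ⟨hhere, hrest⟩ := h
    by_cases hin : mkRec M s₁.1 s₁.2.1 s₁.2.2 ∈ τ.shapes
    · have hτV : τ.V = vol s₁ := by rw [← hV1]; exact (hshapes _ hin).symm
      rw [if_pos ⟨by omega, by omega⟩] at hhere
      have hnode := topShapes_find (M := M) τ.shapes hhere _ hin (by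
        simp only [sorted3, mkRec, Nat.ble_eq, Bool.and_eq_true]; exact hsorted)
      have hst : upd (emptySt M) (mkRec M s₁.1 s₁.2.1 s₁.2.2) = stOf M [s₁] := rfl
      rw [hst] at hnode
      refine node_sound hA hbeat hM (M + 1) [s₁] τ.row τ.shapes L τ.V hH ?_ hlen hdom
        (fun s hs => (hshapes s hs).le) (fun τ' h' => (hlt τ' h').le) hTok' ?_ hnode
      · -- fuel: the family has at most `sumP F ≤ M` members
        have h1 := card_split hH
        have h2 := card_le_sumP hA
        obtain ⟨-, ⟨hP, -, -⟩, -, -⟩ := hA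
        simp only [List.length_singleton] at h1
        omega
      · intro t ht
        rcases hpl t ht with h0 | ⟨τ', hτ', hs⟩
        · simp at h0
        · rcases List.mem_cons.mp hτ' with rfl | h'
          · exact Or.inl hs
          · exact Or.inr ⟨τ', h', hs⟩
    · -- the maximal member lies in a later tier, hence so does every remaining member
      obtain ⟨τ₁, hτ₁, hin₁⟩ := hex
      rcases List.mem_cons.mp hτ₁ with rfl | hτ₁'
      · exact absurd hin₁ hin
      refine top_sound hA hbeat hM hs₁ hmax hsorted hlo hhi L hTok' hrest ⟨τ₁, hτ₁', hin₁⟩ ?_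
      intro t ht
      rcases hpl t ht with h0 | ⟨τ', hτ', hs⟩
      · simp at h0
      · rcases List.mem_cons.mp hτ' with rfl | h'
        · exfalso
          have h1 : vol t = τ'.V := hshapes _ hs
          have h2 : vol s₁ = τ₁.V := (hall τ₁ hτ₁).2.2 _ hin₁
          have h3 := hlt τ₁ hτ₁'
          have h4 := hmax t (Multiset.mem_of_le tsub_le_self ht)
          omega
        · exact Or.inr ⟨τ', h', hs⟩

/-- **Soundness of the checker.** If `teRun M lo hi (rowsDesc n)` accepts (`M ≤ n`, `M ≤ 127`), every family
satisfying `AdmM M` whose value sum exceeds `K · M` and whose member of maximal volume is sorted with volume in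
`[lo, hi)` contains a registered residual. -/
theorem teRun_sound {M lo hi n : ℕ} (hn : M ≤ n) (hM : M ≤ 127) (hrun : teRun M lo hi (rowsDesc n) = true)
    {F : Multiset (ℕ × ℕ × ℕ)} (hA : AdmM M F) (hbeat : K * M < sumVal F) {s₁ : ℕ × ℕ × ℕ} (hs₁ : s₁ ∈ F)
    (hmax : ∀ t ∈ F, vol t ≤ vol s₁) (hsorted : s₁.2.1 ≤ s₁.1 ∧ s₁.2.2 ≤ s₁.2.1) (hlo : lo ≤ vol s₁)
    (hhi : vol s₁ < hi) : ResidualM M F := by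
  obtain ⟨-, -, hall, hex, hpw⟩ := rowsDesc_spec n
  obtain ⟨hok, -, hmem⟩ := mkTiers_spec M (rowsDesc n) (fun r hr => ⟨(hall r hr).1, (hall r hr).2.1,
    (hall r hr).2.2.1⟩) hpw
  -- every member of `F` has its record in some tier
  have hrec : ∀ t ∈ F, ∃ τ ∈ mkTiers M (rowsDesc n), mkRec M t.1 t.2.1 t.2.2 ∈ τ.shapes := by
    intro t ht
    obtain ⟨htab, -, -, h14⟩ := hA
    obtain ⟨h1, h2, h3, ht4⟩ := htab t ht
    have hvM : vol t ≤ M := by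
      have := (tableOK_iff _ _ _ _).mp ht4; exact this.1
    obtain ⟨r, hr, hrV⟩ := hex (vol t) (vol_pos h1 h2 h3) (hvM.trans hn)
    have htt : (t.1, t.2.1, t.2.2) ∈ tierTriples r.V := by
      rw [hrV]; exact mem_tierTriples h1 h2 h3 (tableOK_mono ht4 hM)
    exact hmem r hr (hrV ▸ hvM) _ htt ht4
  refine top_sound hA hbeat hM hs₁ hmax hsorted hlo hhi _ hok hrun (hrec s₁ hs₁) ?_
  intro t ht
  exact Or.inr (hrec t (Multiset.mem_of_le tsub_le_self ht))

end Scan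

end Summit.MatrixMultiplication.MatrixMultiplication.Theorems.TECert
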